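import Literature.AlgebraicGeometry.Frobenioids.Thm36SubPfModelPrep
import Literature.AlgebraicGeometry.Frobenioids.RationalFunctionMonoidExists
import HarnessLib

/-!
# Frobenioids II, Theorem 3.6 (i) "model type" at `Λ = ℚ` — UNCONDITIONAL for small bases: `(C^ℚ)^istr` is
# equivalent to the model Frobenioid of ITS OWN rational function monoid (proof-only)

Mochizuki, *The geometry of Frobenioids II: poly-Frobenioids*, Kyushu J. Math. **62** (2008)
401–460, §3, Theorem 3.6 (i), kurims text p. 36 ll. 34–35 [cite: MochizukiFrdII2008, Thm 3.6 (i) p.36]: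
"The Frobenioid `(C^Λ)^istr` is of … model type, with rational function monoid naturally isomorphic to
`(Φ^fld)^Λ`"; [FrdI] Prop. 4.4 (ii) (2024 Comments (29)(i)) / Thm. 5.2 (iv) p. 101: the rational function
monoid `O^×(−^birat)` of a Frobenioid of isotropic and model type EXISTS and the Frobenioid is equivalent to
its model Frobenioid (abc-iut-w4-d020's `PreFrobenioid.rationalFunctionMonoid_exists`)
[cite: MochizukiFrdI2008, Thm. 5.2(iv) p.101].

PROOF-ONLY file (abc-iut cell, layer L1, row M13-c3 of HOME/staging/L1/L1-t6/g3/M13-c3-DESIGN.md; seat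
abc-iut-L1-t6).  For THE perfection `C^ℚ = C^pf` of the archimedean Frobenioid over a SMALL base
`π : D → D₀` (`D : Type`, `Category.{0} D` — the universe pin of `rationalFunctionMonoid_exists`, which
builds the monoid `X ↦ O^×((P_X)^birat)` inside `Φ`'s universe), the "model type" clause of Thm. 3.6 (i) at
`Λ = ℚ` holds in abc-iut-L1-t9's typed form for SOME model datum — namely the canonical rational function
monoid of `C^pf`: `Thm36Sub.istrModel_Q_exists`.  Inputs BY NAME: `Thm36Sub.pf_isFrobenioid`,
`Thm36Sub.pf_isOfModelType` (`ArchimedeanModelType.lean`), `Thm36Sub.istrAll_Q_holds`,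
`Thm36Sub.istrModel_Q_of_str` (`Thm36SubPfModelPrep.lean`).  What remains of the printed clause is exactly
the IDENTIFICATION of that monoid with `(Φ^fld)^ℚ := (Φ^fld)^pf` (design pieces P2/P3/FILE B-arch), after
which `istrModel_Q_of_str` yields the clause at the printed datum for every base.  Classical; no side taken
on [IUTchIII] Cor. 3.12; no definitions.
-/

noncomputable section

namespace Literature.AlgebraicGeometry.Frobenioids

open CategoryTheory

namespace ArchFrd

namespace Thm36Sub

variable {D : Type} [Category.{0} D] (π : D ⥤ D0)

/-- **Thm. 3.6 (i) "model type" at `Λ = ℚ`, for a small base**: THE perfection `C^pf` admits a rational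
function monoid `(B, Div_B)` ([FrdI] Prop. 4.4 (ii)) for which `(C^pf)^istr ≌` the model Frobenioid of
`(Φ^pf, B, Div_B)` compatibly with the structure functors (`Thm36i_istrModel`).
[cite: MochizukiFrdII2008, Thm 3.6 (i) p.36] -/
theorem istrModel_Q_exists (hF : PreFrobenioid.IsFrobenioid (C.toElem π)) :
    ∃ (B : Dᵒᵖ ⥤ CommMonCat.{0}) (DivB : B ⟶ monoidGp (PreFrobenioid.Perfection.ops hF).monFunctor),
      Nonempty (PreFrobenioid.RationalFunctionMonoidStr (pfStr π hF) (pf_isFrobenioid π hF) B DivB) ∧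
        Thm36i_istrModel (pfStr π hF)
          (ModelFrobenioid.toElem (PreFrobenioid.Perfection.ops hF).monFunctor B DivB) := by
  obtain ⟨B, DivB, ⟨R⟩⟩ := PreFrobenioid.rationalFunctionMonoid_exists (pf_isFrobenioid π hF) _
    (istrAll_Q_holds π hF (fun h => by cases h)) (pf_isOfModelType π hF)
  exact ⟨B, DivB, ⟨R⟩, istrModel_Q_of_str π hF R⟩

end Thm36Sub

end ArchFrd

end Literature.AlgebraicGeometry.Frobenioids

end
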